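import Mathlib
import Summits.Ventures.PercRepro2.SevenTypedAbstract
import Summits.Ventures.PercRepro2.SevenTypedDomLeaf
import Summits.Ventures.PercRepro2.SevenTypedDomShards38
import Summits.Ventures.PercRepro2.SevenTypedDomShards39

/-!
# Seven typed edges, IX.DJ8: a split prefix of the DOMAIN-RESTRICTED rung re-assembled (blind cell
PercRepro2, night-3 g9, 2026-08-25)

The prefix `1 2 3 4 0 6 1 2 1` (depth 9) from its children in SevenTypedDomShards38, SevenTypedDomShards39.
-/

namespace Summit.Ventures.PercRepro2

open UnionCluster

namespace CovForm

namespace TwoTyped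

open OneTyped

section ShardsDJ

set_option maxHeartbeats 0 in
/-- the prefix `1 2 3 4 0 6 1 2 1` (depth 9) re-assembled from its children by `interval_cases`. -/
theorem sh7D_1_2_3_4_0_6_1_2_1 : shard7_9 okQ7Dom 1 2 3 4 0 6 1 2 1 = true := by unfold shard7_9; rw [gd_eq_of_true7 _ _ (by decide), List.all_eq_true]; intro a ha; rw [List.mem_range] at ha; interval_cases a; exacts [(by decide +kernel), (by decide +kernel), (by decide +kernel), sh7D_1_2_3_4_0_6_1_2_1_3, sh7D_1_2_3_4_0_6_1_2_1_4, (by decide +kernel), sh7D_1_2_3_4_0_6_1_2_1_6, (by decide +kernel), (by decide +kernel), (by decide +kernel), sh7D_1_2_3_4_0_6_1_2_1_10]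


end ShardsDJ

end TwoTyped

end CovForm

end Summit.Ventures.PercRepro2
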